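import Summits.CriticalPhenomena.CardyFormulaZ2.Theorems.CardyComplexConeParafermionToSLESixFamiliesDiamondIdentifySideCells
import Summits.CriticalPhenomena.CardyFormulaZ2.Theorems.CardyComplexConeParafermionToSLESixFamiliesDiamondIdentifyRay
import Summits.CriticalPhenomena.CardyFormulaZ2.Theorems.CardyComplexConeParafermionToSLESixFamiliesDiamondIdentifyExactPairs
import Summits.CriticalPhenomena.CardyFormulaZ2.Theorems.CardyComplexConeParafermionToSLESixFamiliesDiamondIdentifyTouchMass
import Mathlib.Analysis.SpecialFunctions.Pow.Continuity
import HarnessLib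

/-!
# Line `potential-darboux-picard-diamond`, stub S4′ (`stub_identifyPotentialPh`): the boundary trace of the potential limit runs along the rays (DIR in the limit)

Helper file of the stub `stub_identifyPotentialPh` of crux `ParafermionToSLESixFamilies` (stmt-CriticalPhenomena-11389).
Step (ii′) of the identification: let `G`, continuous on the closed diamond, be the uniform limit on all cells of the
re-centred renormalised face potentials `u_k^{2/3}Ψ_k − z_k` of exact pairs along positive meshes `u_k → 0` (the output
of `exists_subseq_potentialLimit`), let the phase anchors `a(u_k)` converge to `a⋆`, and let (DIR) of
`ExactPotentialTracePh` hold on the oriented boundary segment `[p, q]` with direction `τ`. Then `G` moves WEAKLY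
MONOTONICALLY ALONG THE RAY `ℝ≥0 · a⋆τ` on `[p, q]`: for `z, z′ ∈ [p, q]` with `proj z ≤ proj z′`,
`G z′ − G z = t · a⋆τ`, `t ≥ 0` (`trace_sub_mem_ray`, registered helper of the crux item). Proof: for interior
parameters, side cells converging to `z, z′` exist for all large `k` (`eventually_exists_sideCell`); the increments
between them converge to `G z′ − G z` (uniform convergence on cells + continuity of `G` on the closed diamond, the
centres of cells lying in the diamond) while staying `C u_k^{2/3}`-close to the rotating rays, whence the limit is on the
limit ray (`mem_ray_of_tendsto_rayDist`); continuity of `G` passes to the closed segment (`sub_mem_ray_of_Ioo`).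
The same sampling (`exists_sideCell_pairs`) evaluates (LOW) of S1′ against clause (c) of S3 on a free segment:
`re_trace_ge_of_low` — the increment of `G` between the points at `1/8` and `7/8` of the segment has component
`≥ c₁ c₀ > 0` along `a⋆τ` (step (iii): one side of the limit polygon has positive length).
-/

noncomputable section

namespace Summit.CriticalPhenomena.CardyFormulaZ2.Cruxes.ParafermionToSLESixFamilies.PotentialDarbouxPicardDiamond

open scoped Topology ComplexConjugate
open Filter Set Metric Complex
open Literature.Probability Literature.Probability.LatticeModels Literature.Probability.Percolation
open Literature.Probability.LatticeModels.DiscreteDobrushin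
open Literature.Probability.RandomPlanarGeometry
open Summit.CriticalPhenomena.CardyFormulaZ2.Cruxes.ParafermionToSLESixFamilies.IicTraceFluxPairing (IsFamily)

/-! ## The coordinate `proj` along an oriented segment -/

/-- The unit-speed parametrisation `p + s σ`, `σ = (q − p)/‖q − p‖`, has coordinate `proj = s`. -/
theorem proj_param {p q : ℂ} (hpq : p ≠ q) (s : ℝ) :
    proj p q (p + (s : ℂ) * ((q - p) / (‖q - p‖ : ℂ))) = s := by
  have hL : (0:ℝ) < ‖q - p‖ := norm_pos_iff.2 (sub_ne_zero.2 hpq.symm)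
  have hL' : (‖q - p‖ : ℂ) ≠ 0 := by exact_mod_cast hL.ne'
  unfold proj
  rw [add_sub_cancel_left, show (s : ℂ) * ((q - p) / (‖q - p‖ : ℂ)) * conj (q - p) =
    (s : ℂ) * ((q - p) * conj (q - p)) / (‖q - p‖ : ℂ) by ring, mul_conj, normSq_eq_norm_sq]
  push_cast
  rw [show (s : ℂ) * ((‖q - p‖ : ℂ) ^ 2) / (‖q - p‖ : ℂ) = ((s * ‖q - p‖ : ℝ) : ℂ) by push_cast; field_simp,
    ofReal_re, mul_div_assoc, div_self hL.ne', mul_one]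

/-- A point of the segment is `p + (proj) σ` with `0 ≤ proj ≤ ‖q − p‖`. -/
theorem eq_param_of_mem_segment {p q z : ℂ} (hpq : p ≠ q) (hz : z ∈ segment ℝ p q) :
    z = p + (proj p q z : ℂ) * ((q - p) / (‖q - p‖ : ℂ)) ∧ 0 ≤ proj p q z ∧ proj p q z ≤ ‖q - p‖ := by
  have hL : (0:ℝ) < ‖q - p‖ := norm_pos_iff.2 (sub_ne_zero.2 hpq.symm)
  have hL' : (‖q - p‖ : ℂ) ≠ 0 := by exact_mod_cast hL.ne'
  rw [segment_eq_image' ℝ p q] at hz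
  obtain ⟨t, ⟨ht0, ht1⟩, rfl⟩ := hz
  have hzt : p + t • (q - p) = p + ((t * ‖q - p‖ : ℝ) : ℂ) * ((q - p) / (‖q - p‖ : ℂ)) := by
    rw [real_smul]; push_cast; field_simp
  have hproj : proj p q (p + t • (q - p)) = t * ‖q - p‖ := by rw [hzt, proj_param hpq]
  rw [hproj]
  exact ⟨hzt, by positivity, by nlinarith⟩

/-- `proj` is `1`-Lipschitz. -/
theorem abs_proj_sub_le (p q a b : ℂ) : |proj p q a - proj p q b| ≤ ‖a - b‖ := by
  unfold proj
  rcases eq_or_ne (‖q - p‖) 0 with h0 | h0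
  · rw [h0, div_zero, div_zero, sub_zero, abs_zero]; exact norm_nonneg _
  have hL : 0 < ‖q - p‖ := lt_of_le_of_ne (norm_nonneg _) (Ne.symm h0)
  rw [← sub_div, ← sub_re, show (a - p) * conj (q - p) - (b - p) * conj (q - p) = (a - b) * conj (q - p) by ring,
    abs_div, abs_of_pos hL, div_le_iff₀ hL]
  calc |((a - b) * conj (q - p)).re| ≤ ‖(a - b) * conj (q - p)‖ := abs_re_le_norm _
    _ = ‖a - b‖ * ‖q - p‖ := by rw [norm_mul, norm_conj]

/-! ## Sampling the trace by side cells -/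

/-- In a marked diamond the centres of cells lie in the carrier (along an admissible family). -/
theorem ctr_mem_carrier_of_isFamily {D : DobrushinDomain} (hD : IsMarkedDiamond D) {Λ : ℝ → DiscreteDobrushin}
    (hΛ : IsFamily D Λ) (δ : ℝ) {f : Site 2} (hf : IsCell (Λ δ) f) : ctr δ f ∈ D.carrier := by
  have hconvex : Convex ℝ D.carrier := by
    obtain ⟨c, α, β, -, -, hcar⟩ := hD; rw [hcar]; exact convex_tiltedBox c _ α β
  have h1 : (Λ δ).Ω = D.carrier := hΛ.1 _
  have h2 : (Λ δ).δ = δ := hΛ.2.1 _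
  have := ctr_mem_carrier_of_isCell (E := Λ δ) (by rw [h1]; exact hconvex) hf
  rwa [h1, h2] at this

/-- **Sampling two points of a boundary segment by side cells.** Along positive meshes `u_k → 0`, for two points
`w, w′` of an oriented boundary segment `[p, q]` at distance `> η` from the endpoints, there are side cells
`f_k, f′_k ∈ sideCells (Λ (u k)) (u k) p q η` with centres within `3 u_k` of `w, w′` for all large `k`, and — if `G`,
continuous on the closed diamond, is the uniform limit on cells of `u_k^{2/3}Ψ_k − z_k` — the renormalised increments
`u_k^{2/3}(Ψ_k f′_k − Ψ_k f_k)` converge to `G w′ − G w`. -/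
theorem exists_sideCell_pairs {D : DobrushinDomain} (hD : IsMarkedDiamond D) {Λ : ℝ → DiscreteDobrushin}
    (hΛ : IsFamily D Λ) {p q : ℂ} (hpq : IsBdrySegment D p q) {u : ℕ → ℝ} (hu : ∀ k, 0 < u k)
    (hu0 : Tendsto u atTop (𝓝 0)) {P : ℕ → (Site 2 → ℂ) × (Site 2 → ℂ)} {zc : ℕ → ℂ} {G : ℂ → ℂ}
    (hGc : ContinuousOn G (closure D.carrier))
    (hunif : ∀ ε > (0:ℝ), ∀ᶠ k in atTop, ∀ f : Site 2, IsCell (Λ (u k)) f →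
      ‖(((u k) ^ ((2:ℝ) / 3) : ℝ) : ℂ) * (P k).2 f - zc k - G (ctr (u k) f)‖ ≤ ε)
    {η : ℝ} (hη : 0 < η) {w w' : ℂ} (hw : w ∈ segment ℝ p q) (hw' : w' ∈ segment ℝ p q) (hwp : η < dist w p)
    (hwq : η < dist w q) (hw'p : η < dist w' p) (hw'q : η < dist w' q) :
    ∃ ff : ℕ → Site 2 × Site 2,
      (∀ᶠ k in atTop, ((ff k).1 ∈ sideCells (Λ (u k)) (u k) p q η ∧ dist w (ctr (u k) (ff k).1) ≤ 3 * u k) ∧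
        ((ff k).2 ∈ sideCells (Λ (u k)) (u k) p q η ∧ dist w' (ctr (u k) (ff k).2) ≤ 3 * u k)) ∧
      Tendsto (fun k => (((u k) ^ ((2:ℝ) / 3) : ℝ) : ℂ) * ((P k).2 (ff k).2 - (P k).2 (ff k).1)) atTop
        (𝓝 (G w' - G w)) := by
  have hclos : segment ℝ p q ⊆ closure D.carrier := hpq.2.1.trans frontier_subset_closure
  -- side cells near `w` and `w'`
  have hcw := eventually_atTop_of_eventually_nhdsGT hu hu0 (eventually_exists_sideCell D hD Λ hΛ p q hpq η hη w hw hwp hwq)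
  have hcw' := eventually_atTop_of_eventually_nhdsGT hu hu0
    (eventually_exists_sideCell D hD Λ hΛ p q hpq η hη w' hw' hw'p hw'q)
  obtain ⟨K₁, hK₁⟩ := eventually_atTop.1 (hcw.and hcw')
  have hch : ∀ k, ∃ ff : Site 2 × Site 2, K₁ ≤ k →
      (ff.1 ∈ sideCells (Λ (u k)) (u k) p q η ∧ dist w (ctr (u k) ff.1) ≤ 3 * u k) ∧
      (ff.2 ∈ sideCells (Λ (u k)) (u k) p q η ∧ dist w' (ctr (u k) ff.2) ≤ 3 * u k) := by
    intro k
    by_cases hk : K₁ ≤ k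
    · obtain ⟨⟨f, hf, hfd⟩, ⟨f', hf', hf'd⟩⟩ := hK₁ k hk
      exact ⟨(f, f'), fun _ => ⟨⟨hf, hfd⟩, ⟨hf', hf'd⟩⟩⟩
    · exact ⟨(0, 0), fun h => (hk h).elim⟩
  choose ff hff using hch
  have hKev : ∀ᶠ k in atTop, K₁ ≤ k := eventually_ge_atTop K₁
  refine ⟨ff, hKev.mono fun k hk => hff k hk, ?_⟩
  -- convergence of `G` along the centres
  have hGlim : ∀ (c : ℕ → ℂ) (w₀ : ℂ), w₀ ∈ segment ℝ p q → (∀ᶠ k in atTop, c k ∈ D.carrier) →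
      (∀ᶠ k in atTop, dist w₀ (c k) ≤ 3 * u k) → Tendsto (fun k => G (c k)) atTop (𝓝 (G w₀)) := by
    intro c w₀ hw₀ hcD hcd
    have hc0 : Tendsto c atTop (𝓝 w₀) := by
      refine Metric.tendsto_atTop'.2 fun ε hε => ?_
      have h3 : ∀ᶠ k in atTop, 3 * u k < ε := by
        have : Tendsto (fun k => 3 * u k) atTop (𝓝 (3 * 0)) := hu0.const_mul 3
        rw [mul_zero] at this
        exact this.eventually (gt_mem_nhds hε)
      obtain ⟨K, hK⟩ := eventually_atTop.1 (hcd.and h3)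
      refine ⟨K, fun k hk => ?_⟩
      have := hK k hk.le
      rw [dist_comm]; linarith [this.1, this.2]
    have hcw : Tendsto c atTop (𝓝[closure D.carrier] w₀) :=
      tendsto_nhdsWithin_iff.2 ⟨hc0, hcD.mono fun k hk => subset_closure hk⟩
    exact (hGc w₀ (hclos hw₀)).tendsto.comp hcw
  have hG1 : Tendsto (fun k => G (ctr (u k) (ff k).1)) atTop (𝓝 (G w)) :=
    hGlim _ w hw (hKev.mono fun k hk => ctr_mem_carrier_of_isFamily hD hΛ _ ((hff k hk).1.1).1)
      (hKev.mono fun k hk => (hff k hk).1.2)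
  have hG2 : Tendsto (fun k => G (ctr (u k) (ff k).2)) atTop (𝓝 (G w')) :=
    hGlim _ w' hw' (hKev.mono fun k hk => ctr_mem_carrier_of_isFamily hD hΛ _ ((hff k hk).2.1).1)
      (hKev.mono fun k hk => (hff k hk).2.2)
  -- the re-centred values converge to `0`
  have hA : ∀ i : Fin 2, Tendsto (fun k => (((u k) ^ ((2:ℝ) / 3) : ℝ) : ℂ) * (P k).2 (if i = 0 then (ff k).1 else (ff k).2) -
      zc k - G (ctr (u k) (if i = 0 then (ff k).1 else (ff k).2))) atTop (𝓝 0) := by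
    intro i
    refine Metric.tendsto_nhds.2 fun ε hε => ?_
    filter_upwards [hunif (ε / 2) (half_pos hε), hKev] with k hk hkK
    rw [dist_zero_right]
    have hcell : IsCell (Λ (u k)) (if i = 0 then (ff k).1 else (ff k).2) := by
      split_ifs
      · exact ((hff k hkK).1.1).1
      · exact ((hff k hkK).2.1).1
    exact lt_of_le_of_lt (hk _ hcell) (half_lt_self hε)
  have hA1 := hA 0
  have hA2 := hA 1
  simp only [if_true, show (1 : Fin 2) ≠ 0 from by decide, if_false] at hA1 hA2
  have hsum := ((hA2.sub hA1).add (hG2.sub hG1))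
  rw [zero_sub_zero, zero_add] at hsum
  refine hsum.congr fun k => ?_
  ring

/-! ## DIR in the limit -/

/-- **The boundary trace of the potential limit runs weakly monotonically along the ray `ℝ≥0 · a⋆τ`.** -/
theorem trace_sub_mem_ray : ∀ (D : DobrushinDomain), IsMarkedDiamond D → ∀ (Λ : ℝ → DiscreteDobrushin), IsFamily D Λ → ∀ (τ : ℂ) (aA : ℝ → ℂ) (C : ℝ) (p q : ℂ), IsBdrySegment D p q → (∀ η : ℝ, 0 < η → ∀ᶠ δ in 𝓝[>] (0:ℝ), ∀ Φ Ψ : Site 2 → ℂ, IsExactPair (Λ δ) δ Φ Ψ → ∀ f f' : Site 2, f ∈ sideCells (Λ δ) δ p q η → f' ∈ sideCells (Λ δ) δ p q η → proj p q (ctr δ f) ≤ proj p q (ctr δ f') → rayDist (aA δ * τ) (((δ ^ ((2:ℝ) / 3) : ℝ) : ℂ) * (Ψ f' - Ψ f)) ≤ C * δ ^ ((2:ℝ) / 3)) → ∀ (u : ℕ → ℝ), (∀ k, 0 < u k) → Tendsto u atTop (𝓝 0) → (∀ k, ‖aA (u k)‖ = 1) → ∀ (P : ℕ → (Site 2 →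 ℂ) × (Site 2 → ℂ)) (zc : ℕ → ℂ) (alim : ℂ) (G : ℂ → ℂ), (∀ k, IsExactPair (Λ (u k)) (u k) (P k).1 (P k).2) → Tendsto (fun k => aA (u k)) atTop (𝓝 alim) → ContinuousOn G (closure D.carrier) → (∀ ε > (0:ℝ), ∀ᶠ k in atTop, ∀ f : Site 2, IsCell (Λ (u k)) f → ‖(((u k) ^ ((2:ℝ) / 3) : ℝ) : ℂ) * (P k).2 f - zc k - G (ctr (u k) f)‖ ≤ ε) → ∀ z ∈ segment ℝ p q, ∀ z' ∈ segment ℝ p q, proj p q z ≤ proj p q z' → ∃ t : ℝ, 0 ≤ t ∧ G z' - G z = t * (alim * τ) := by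
  intro D hD Λ hΛ τ aA C p q hpq hDIR u hu hu0 ha P zc alim G hP halim hGc hunif z hz z' hz' hzz'
  have hpq' : p ≠ q := hpq.1
  set L : ℝ := ‖q - p‖ with hL
  have hL0 : 0 < L := norm_pos_iff.2 (sub_ne_zero.2 hpq'.symm)
  set σ : ℂ := (q - p) / (L : ℂ) with hσ
  have hσ1 : ‖σ‖ = 1 := by
    rw [hσ, norm_div, norm_real, Real.norm_eq_abs, abs_of_pos hL0, hL, div_self hL0.ne']
  -- the unit-speed parametrisation and its basic properties
  have hmem : ∀ s : ℝ, 0 ≤ s → s ≤ L → p + (s : ℂ) * σ ∈ segment ℝ p q := by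
    intro s hs0 hsL
    rw [segment_eq_image' ℝ p q]
    refine ⟨s / L, ⟨div_nonneg hs0 hL0.le, (div_le_one hL0).2 hsL⟩, ?_⟩
    show p + (s / L) • (q - p) = p + (s : ℂ) * σ
    have hLc : (L : ℂ) ≠ 0 := by exact_mod_cast hL0.ne'
    rw [real_smul, hσ]; push_cast; field_simp
  have hdistp : ∀ s : ℝ, 0 ≤ s → dist (p + (s : ℂ) * σ) p = s := fun s hs => by
    rw [dist_eq_norm, add_sub_cancel_left, norm_mul, norm_real, Real.norm_eq_abs, abs_of_nonneg hs, hσ1, mul_one]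
  have hdistq : ∀ s : ℝ, s ≤ L → dist (p + (s : ℂ) * σ) q = L - s := fun s hs => by
    have : p + (s : ℂ) * σ - q = ((s - L : ℝ) : ℂ) * σ := by
      have hLc : (L : ℂ) ≠ 0 := by exact_mod_cast hL0.ne'
      rw [hσ]; push_cast; field_simp; ring
    rw [dist_eq_norm, this, norm_mul, norm_real, Real.norm_eq_abs, hσ1, mul_one, abs_of_nonpos (by linarith)]
    ring
  have hclos : segment ℝ p q ⊆ closure D.carrier := hpq.2.1.trans frontier_subset_closure
  have hu23 : Tendsto (fun k => (u k) ^ ((2:ℝ) / 3)) atTop (𝓝 0) := by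
    have h := ((Real.continuous_rpow_const (by norm_num : (0:ℝ) ≤ 2 / 3)).tendsto 0).comp hu0
    rwa [Function.comp_def, Real.zero_rpow (by norm_num)] at h
  -- the interior statement
  have hIoo : ∀ s s' : ℝ, 0 < s → s < s' → s' < L →
      ∃ r : ℝ, 0 ≤ r ∧ G (p + (s' : ℂ) * σ) - G (p + (s : ℂ) * σ) = r * (alim * τ) := by
    intro s s' hs hss' hs'
    set w : ℂ := p + (s : ℂ) * σ with hw
    set w' : ℂ := p + (s' : ℂ) * σ with hw'
    set η : ℝ := min s (L - s') / 2 with hη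
    have hmin : 0 < min s (L - s') := lt_min hs (by linarith)
    have hη0 : 0 < η := by rw [hη]; exact half_pos hmin
    have hηs : η < s := by rw [hη]; linarith [min_le_left s (L - s')]
    have hηs' : η < L - s' := by rw [hη]; linarith [min_le_right s (L - s')]
    obtain ⟨ff, hff, hxlim⟩ := exists_sideCell_pairs hD hΛ hpq hu hu0 (P := P) hGc hunif hη0 (hmem s hs.le (by linarith))
      (hmem s' (by linarith) hs'.le) (by rw [hdistp s hs.le]; exact hηs) (by rw [hdistq s (by linarith)]; linarith)
      (by rw [hdistp s' (by linarith)]; linarith) (by rw [hdistq s' hs'.le]; exact hηs')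
    -- the increments stay close to the rotating rays
    have hray : ∀ᶠ k in atTop, rayDist (aA (u k) * τ)
        ((((u k) ^ ((2:ℝ) / 3) : ℝ) : ℂ) * ((P k).2 (ff k).2 - (P k).2 (ff k).1)) ≤ C * (u k) ^ ((2:ℝ) / 3) := by
      have h6 : ∀ᶠ k in atTop, 6 * u k < s' - s := by
        have : Tendsto (fun k => 6 * u k) atTop (𝓝 (6 * 0)) := hu0.const_mul 6
        rw [mul_zero] at this
        exact this.eventually (gt_mem_nhds (by linarith))
      filter_upwards [eventually_atTop_of_eventually_nhdsGT hu hu0 (hDIR η hη0), hff, h6] with k hk hffk h6k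
      obtain ⟨⟨hf, hfd⟩, ⟨hf', hf'd⟩⟩ := hffk
      refine hk _ _ (hP k) _ _ hf hf' ?_
      have h1 : |proj p q (ctr (u k) (ff k).1) - proj p q w| ≤ 3 * u k :=
        (abs_proj_sub_le p q (ctr (u k) (ff k).1) w).trans (by rw [← dist_eq_norm, dist_comm]; exact hfd)
      have h2 : |proj p q (ctr (u k) (ff k).2) - proj p q w'| ≤ 3 * u k :=
        (abs_proj_sub_le p q (ctr (u k) (ff k).2) w').trans (by rw [← dist_eq_norm, dist_comm]; exact hf'd)
      rw [hw, proj_param hpq'] at h1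
      rw [hw', proj_param hpq'] at h2
      have h1' := abs_le.1 h1
      have h2' := abs_le.1 h2
      linarith
    have hε0 : Tendsto (fun k => C * (u k) ^ ((2:ℝ) / 3)) atTop (𝓝 0) := by
      simpa using hu23.const_mul C
    exact mem_ray_of_tendsto_rayDist τ (fun k => aA (u k)) alim _ (G w' - G w) (fun k => C * (u k) ^ ((2:ℝ) / 3))
      (fun k => ha k) halim hxlim hε0 hray
  -- continuity along the closed segment, and the conclusion
  have hcont : ContinuousOn (fun s : ℝ => G (p + (s : ℂ) * σ)) (Icc 0 L) := by
    refine hGc.comp (by fun_prop) fun s hs => hclos (hmem s hs.1 hs.2)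
  have hall := sub_mem_ray_of_Ioo G p σ (alim * τ) L hcont hIoo
  obtain ⟨hzeq, hz0, hzL⟩ := eq_param_of_mem_segment hpq' hz
  obtain ⟨hz'eq, hz'0, hz'L⟩ := eq_param_of_mem_segment hpq' hz'
  obtain ⟨r, hr, hreq⟩ := hall (proj p q z) (proj p q z') hz0 hzz' hz'L
  refine ⟨r, hr, ?_⟩
  rw [hzeq, hz'eq]
  exact hreq

/-! ## LOW against the touch-mass lower bound: a side of positive length -/

/-- **A free side of positive length.** If (LOW) of S1′ holds on the oriented boundary segment `[p, q]` (constants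
`c₁ ≥ 0`, `C`, direction `τ`, anchors `aA`) and the renormalised touch mass of its middle half is eventually `≥ c₀`
(clause (c) of S3), then the increment of the potential limit `G` between the points at `1/8` and `7/8` of the segment
has component `≥ c₁ c₀` along `a⋆τ`. -/
theorem re_trace_ge_of_low : ∀ (D : DobrushinDomain), IsMarkedDiamond D → ∀ (Λ : ℝ → DiscreteDobrushin), IsFamily D Λ → ∀ (τ : ℂ) (aA : ℝ → ℂ) (C c₁ c₀ : ℝ) (p q : ℂ), IsBdrySegment D p q → 0 ≤ c₁ → (∀ η : ℝ, 0 < η → ∀ᶠ δ in 𝓝[>] (0:ℝ), ∀ Φ Ψ : Site 2 → ℂ, IsExactPair (Λ δ) δ Φ Ψ → ∀ f f' : Site 2, f ∈ sideCells (Λ δ) δ p q η → f' ∈ sideCells (Λ δ) δ p q η → proj p q (ctr δ f) ≤ proj p q (ctr δ f') → c₁ * touchMass (Λ δ) δ p q (proj p q (ctr δ f) + 3 * δ) (proj p q (ctr δ f') - 3 * δ) - C * δ ^ ((2:ℝ) / 3) ≤ ((starRingEnd ℂ) (aA δ * τ) * ((((δ ^ ((2:ℝ) / 3) : ℝ) :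 ℂ) * (Ψ f' - Ψ f)))).re) → (∀ᶠ δ in 𝓝[>] (0:ℝ), c₀ ≤ touchMass (Λ δ) δ p q (‖q - p‖ / 4) (3 * ‖q - p‖ / 4)) → ∀ (u : ℕ → ℝ), (∀ k, 0 < u k) → Tendsto u atTop (𝓝 0) → ∀ (P : ℕ → (Site 2 → ℂ) × (Site 2 → ℂ)) (zc : ℕ → ℂ) (alim : ℂ) (G : ℂ → ℂ), (∀ k, IsExactPair (Λ (u k)) (u k) (P k).1 (P k).2) → Tendsto (fun k => aA (u k)) atTop (𝓝 alim) → ContinuousOn G (closure D.carrier) → (∀ ε > (0:ℝ), ∀ᶠ k in atTop, ∀ f : Site 2, IsCell (Λ (u k)) f → ‖(((u k) ^ ((2:ℝ) / 3) : ℝ) : ℂ) * (P k).2 f - zc k - G (ctr (u k) f)‖ ≤ ε) → c₁ * c₀ ≤ ((starRingEnd ℂ) (alim * τ) * (G (p + ((7 / 8 : ℝ) : ℂ) * (q - p)) - G (p + ((1 / 8 : ℝ) : ℂ) * (q - p)))).re := by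
  intro D hD Λ hΛ τ aA C c₁ c₀ p q hpq hc₁ hLOW hmass u hu hu0 P zc alim G hP halim hGc hunif
  have hpq' : p ≠ q := hpq.1
  set L : ℝ := ‖q - p‖ with hL
  have hL0 : 0 < L := norm_pos_iff.2 (sub_ne_zero.2 hpq'.symm)
  -- the two sample points
  set w : ℂ := p + ((1 / 8 : ℝ) : ℂ) * (q - p) with hw
  set w' : ℂ := p + ((7 / 8 : ℝ) : ℂ) * (q - p) with hw'
  have hparam : ∀ t : ℝ, p + (t : ℂ) * (q - p) = p + ((t * L : ℝ) : ℂ) * ((q - p) / (‖q - p‖ : ℂ)) := fun t => by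
    have hLc : (L : ℂ) ≠ 0 := by exact_mod_cast hL0.ne'
    rw [← hL]; push_cast; rw [mul_div_assoc', mul_assoc, mul_div_assoc, mul_div_cancel_left₀ _ hLc]
  have hmemt : ∀ t : ℝ, 0 ≤ t → t ≤ 1 → p + (t : ℂ) * (q - p) ∈ segment ℝ p q := fun t ht0 ht1 => by
    rw [segment_eq_image' ℝ p q]; exact ⟨t, ⟨ht0, ht1⟩, by simp only [real_smul]⟩
  have hprojt : ∀ t : ℝ, proj p q (p + (t : ℂ) * (q - p)) = t * L := fun t => by rw [hparam t, proj_param hpq']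
  have hdistpt : ∀ t : ℝ, 0 ≤ t → dist (p + (t : ℂ) * (q - p)) p = t * L := fun t ht => by
    rw [dist_eq_norm, add_sub_cancel_left, norm_mul, norm_real, Real.norm_eq_abs, abs_of_nonneg ht]
  have hdistqt : ∀ t : ℝ, t ≤ 1 → dist (p + (t : ℂ) * (q - p)) q = (1 - t) * L := fun t ht => by
    rw [dist_eq_norm, show p + (t : ℂ) * (q - p) - q = ((1 - t : ℝ) : ℂ) * (-(q - p)) by push_cast; ring, norm_mul,
      norm_neg, norm_real, Real.norm_eq_abs, abs_of_nonneg (by linarith)]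
  have hη0 : 0 < L / 16 := by positivity
  obtain ⟨ff, hff, hxlim⟩ := exists_sideCell_pairs hD hΛ hpq hu hu0 (P := P) hGc hunif hη0
    (hmemt (1 / 8) (by norm_num) (by norm_num)) (hmemt (7 / 8) (by norm_num) (by norm_num))
    (by rw [hdistpt _ (by norm_num)]; linarith) (by rw [hdistqt _ (by norm_num)]; linarith)
    (by rw [hdistpt _ (by norm_num)]; linarith) (by rw [hdistqt _ (by norm_num)]; linarith)
  -- (LOW) along the sequence, against the touch mass of the middle half
  have hlow : ∀ᶠ k in atTop, c₁ * c₀ - C * (u k) ^ ((2:ℝ) / 3) ≤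
      ((starRingEnd ℂ) (aA (u k) * τ) * ((((u k) ^ ((2:ℝ) / 3) : ℝ) : ℂ) * ((P k).2 (ff k).2 - (P k).2 (ff k).1))).re := by
    have h48 : ∀ᶠ k in atTop, 48 * u k < L := by
      have : Tendsto (fun k => 48 * u k) atTop (𝓝 (48 * 0)) := hu0.const_mul 48
      rw [mul_zero] at this
      exact this.eventually (gt_mem_nhds hL0)
    filter_upwards [eventually_atTop_of_eventually_nhdsGT hu hu0 (hLOW (L / 16) hη0),
      eventually_atTop_of_eventually_nhdsGT hu hu0 hmass, hff, h48] with k hk hmk hffk h48k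
    obtain ⟨⟨hf, hfd⟩, ⟨hf', hf'd⟩⟩ := hffk
    have h1 : |proj p q (ctr (u k) (ff k).1) - proj p q w| ≤ 3 * u k :=
      (abs_proj_sub_le p q (ctr (u k) (ff k).1) w).trans (by rw [← dist_eq_norm, dist_comm]; exact hfd)
    have h2 : |proj p q (ctr (u k) (ff k).2) - proj p q w'| ≤ 3 * u k :=
      (abs_proj_sub_le p q (ctr (u k) (ff k).2) w').trans (by rw [← dist_eq_norm, dist_comm]; exact hf'd)
    rw [hw, hprojt] at h1
    rw [hw', hprojt] at h2
    have h1' := abs_le.1 h1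
    have h2' := abs_le.1 h2
    have hle := hk _ _ (hP k) _ _ hf hf' (by linarith)
    have hmono : touchMass (Λ (u k)) (u k) p q (‖q - p‖ / 4) (3 * ‖q - p‖ / 4) ≤
        touchMass (Λ (u k)) (u k) p q (proj p q (ctr (u k) (ff k).1) + 3 * u k)
          (proj p q (ctr (u k) (ff k).2) - 3 * u k) :=
      touchMass_mono _ _ p q _ _ _ _ (hu k) (by rw [← hL]; linarith) (by rw [← hL]; linarith)
    have : c₁ * c₀ ≤ c₁ * touchMass (Λ (u k)) (u k) p q (proj p q (ctr (u k) (ff k).1) + 3 * u k)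
        (proj p q (ctr (u k) (ff k).2) - 3 * u k) := mul_le_mul_of_nonneg_left (hmk.trans hmono) hc₁
    linarith
  -- pass to the limit
  have hu23 : Tendsto (fun k => (u k) ^ ((2:ℝ) / 3)) atTop (𝓝 0) := by
    have h := ((Real.continuous_rpow_const (by norm_num : (0:ℝ) ≤ 2 / 3)).tendsto 0).comp hu0
    rwa [Function.comp_def, Real.zero_rpow (by norm_num)] at h
  have hleft : Tendsto (fun k => c₁ * c₀ - C * (u k) ^ ((2:ℝ) / 3)) atTop (𝓝 (c₁ * c₀)) := by
    simpa using tendsto_const_nhds.sub (hu23.const_mul C)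
  have hright : Tendsto (fun k => ((starRingEnd ℂ) (aA (u k) * τ) *
      ((((u k) ^ ((2:ℝ) / 3) : ℝ) : ℂ) * ((P k).2 (ff k).2 - (P k).2 (ff k).1))).re) atTop
      (𝓝 (((starRingEnd ℂ) (alim * τ) * (G w' - G w)).re)) :=
    (continuous_re.tendsto _).comp (((continuous_conj.tendsto _).comp (halim.mul tendsto_const_nhds)).mul hxlim)
  exact le_of_tendsto_of_tendsto hleft hright hlow

end Summit.CriticalPhenomena.CardyFormulaZ2.Cruxes.ParafermionToSLESixFamilies.PotentialDarbouxPicardDiamond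

end
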